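import Literature.AlgebraicGeometry.Hu2025.Statements.S06WpEllBlowups.R108bProp611Items
import Literature.AlgebraicGeometry.Hu2025.Statements.S06WpEllBlowups.R108cEquationsWpEll
import Mathlib.Algebra.MvPolynomial.Nilpotent
import HarnessLib

/-!
# Hu 2025 row 108 (§6.3–6.4), NON-VACUITY CERTIFICATES for the lanes' vacuity column (M-Hu-min; typer of record
# res-type-081): the typed candidates `Prop6_11_labels` (file a) and `Prop6_18_1a` (file c) are each SATISFIABLE and
# REFUTABLE on OUR carriers — neither trivially true nor trivially false as typed. Nothing of the source asserted.

Source status (D-0012 / D-0089): Y. Hu, arXiv:2507.21400v1 [Hu2025] — UNREFEREED PREPRINT UNDER ADJUDICATION; locators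
`C<cc>L<l>` = TeX chunk + line of `paper:arxiv-2507.21400`, PDF page next to it. The witnesses are TOYS on the typed
record `WpEllChart` (a one-block ℓ-chart over `ℚ[X₀,X₁,X₂]`: `𝔢 = ∅`, `𝔡 = 𝔩 = {F}`, two exceptional divisors labelled
by `L_F` and by `(m,u_F)`, both cut out by `X₂`; `𝒱̃ ∩ 𝔙 = (X₀ = 0)`) and on exponent vectors over `Fin 3`; they are NOT
models of Hu's charts and say nothing about the preprint's statements. They also record the typing point O1 of
HOME/plan/tools/res-type-081/hu/T9-AUDIT-row108.md in the kernel: with `ltIdx F = none` the set-level reading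
`deltaLt ⊆ del` holds (vacuously) while the element-wise conjunct (iv) of `Prop6_11_labels` fails.
Hypotheses: none — modulo []. Axioms: propext, Classical.choice, Quot.sound. AI typing/proving, weaker than expert review.
-/

noncomputable section

open MvPolynomial

namespace Literature.AlgebraicGeometry.Hu2025.Statements.S06WpEllBlowups

namespace Prop611Sanity

/-- A coordinate variable of `ℚ[X₀,X₁,X₂]` is not a unit.
[cite: Hu2025, Prop. 6.11 C47L36–C48L55, pp. 106–109 (unrefereed preprint arXiv:2507.21400v1 under adjudication, D-0012/D-0089 — kernel support on OUR typed carrier of row 108; nothing of the source asserted)] -/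
theorem X_not_isUnit (i : Fin 3) : ¬ IsUnit (X i : MvPolynomial (Fin 3) ℚ) := by
  intro h
  have h0 := (MvPolynomial.isUnit_iff_totalDegree_of_isReduced.mp h).2
  simp [MvPolynomial.totalDegree_X] at h0

/-- **`Prop6_11_labels` (Prop. 6.11, labels clause C47L70–L97 + «𝔡^lt_𝔙 ⊂ 𝔡_𝔙» C47L81; p.107) is SATISFIABLE on an
admissible chart record:** the one-block toy ℓ-chart over `ℚ[X₀,X₁,X₂]` with `ltIdx F = some (m,u_F)` (two exceptional
divisors, labelled by `L_F ∈ 𝔩_𝔙` and by `(m,u_F) ∈ 𝔡_𝔙`).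
[cite: Hu2025, Prop. 6.11 (labels clause) C47L70–L97, p. 107 (unrefereed preprint arXiv:2507.21400v1 under adjudication, D-0012/D-0089 — kernel support on OUR typed carrier of row 108; nothing of the source asserted)] -/
theorem exists_isAdmissible_and_Prop6_11_labels :
    ∃ C : WpEllChart Unit Unit Unit Bool (MvPolynomial (Fin 3) ℚ), IsAdmissible C ∧ Prop6_11_labels C := by
  refine ⟨WpEllChart.mk (eps := ∅) (del := {()}) (ell := {()}) (ltIdx := fun _ => some ()) (var₁ := fun _ => X 0)
    (var₂ := fun _ => 1 + X 1) (deltaEll := fun _ => X 2) (plDiv := fun _ => Ideal.span {X 0}) (rhoDiv := fun _ => ⊤)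
    (excDiv := fun _ => Ideal.span {X 2})
    (lab := fun b => if b then some (Sum.inr (Sum.inr ())) else some (Sum.inr (Sum.inl ())))
    (ellForm := fun _ => 1 + (1 + X 1)) (vIdeal := Ideal.span {X 0}), ?_, ?_⟩
  · exact Ideal.span_singleton_ne_top (X_not_isUnit 0)
  have hE : ∀ E : Bool, (Ideal.span {(X 2 : MvPolynomial (Fin 3) ℚ)}) ≠ ⊤ := fun _ =>
    Ideal.span_singleton_ne_top (X_not_isUnit 2)
  refine ⟨?_, ?_, ?_, ?_, ?_⟩
  · intro E
    refine ⟨fun _ => ?_, fun _ => hE E⟩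
    cases E <;> simp
  · intro E l hl
    cases E <;> simp only [Option.some.injEq, Bool.false_eq_true, if_false, if_true] at hl <;>
      subst hl <;> simp
  · intro E₁ E₂ l h₁ h₂
    cases E₁ <;> cases E₂ <;> simp only [Bool.false_eq_true, if_false, if_true, Option.some.injEq] at h₁ h₂ <;>
      first | rfl | (subst h₁; cases h₂)
  · intro l hl
    rcases l with w | uv | F
    · simp at hl
    · exact ⟨false, by simp⟩
    · exact ⟨true, by simp⟩
  · intro F _
    exact ⟨(), rfl, by simp⟩

/-- **`Prop6_11_labels` is REFUTABLE on an admissible chart record (so it is not trivially true as typed):** the same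
toy with `ltIdx F = none` while `L_F ∈ 𝔩_𝔙` — the element-wise conjunct (iv) («(m,u_F) ∈ 𝔡_𝔙 for every L_F ∈ 𝔩_𝔙»,
C47L81) fails, although the set-level reading `deltaLt ⊆ del` holds there vacuously (`deltaLt = ∅`; second conjunct).
[cite: Hu2025, Prop. 6.11 (labels clause) C47L70–L97, p. 107 (unrefereed preprint arXiv:2507.21400v1 under adjudication, D-0012/D-0089 — kernel support on OUR typed carrier of row 108; nothing of the source asserted)] -/
theorem exists_isAdmissible_and_not_Prop6_11_labels :
    ∃ C : WpEllChart Unit Unit Unit Bool (MvPolynomial (Fin 3) ℚ),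
      IsAdmissible C ∧ ¬ Prop6_11_labels C ∧ C.deltaLt ⊆ C.del := by
  refine ⟨WpEllChart.mk (eps := ∅) (del := {()}) (ell := {()}) (ltIdx := fun _ => none) (var₁ := fun _ => X 0)
    (var₂ := fun _ => 1 + X 1) (deltaEll := fun _ => X 2) (plDiv := fun _ => Ideal.span {X 0}) (rhoDiv := fun _ => ⊤)
    (excDiv := fun _ => Ideal.span {X 2})
    (lab := fun b => if b then some (Sum.inr (Sum.inr ())) else some (Sum.inr (Sum.inl ())))
    (ellForm := fun _ => 1 + (1 + X 1)) (vIdeal := Ideal.span {X 0}), ?_, ?_, ?_⟩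
  · exact Ideal.span_singleton_ne_top (X_not_isUnit 0)
  · intro h
    obtain ⟨uv, huv, -⟩ := h.2.2.2.2 () (by simp)
    simp at huv
  · simp [WpEllChart.deltaLt]

/-- **`Prop6_18_1a` (Prop. 6.18 (1)(1a), C53L85–L99; p.120) is SATISFIABLE at exponent level:** over `V = Fin 3`
(`ζ = 0`, `y₁ = 1`, `y₁' = 2`) take `T⁺ = 1`, `T⁻ = y₁`, `T⁺' = T⁻' = y₁'` (then `b = 1`: `deg_ζ T⁻ = 0`, `deg_{y₁} T⁻ = 1`,
`T⁻` linear in `y₁`; `deg T⁺ + 1 = deg T⁺'`).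
[cite: Hu2025, Prop. 6.18 (1a) C53L85–L99, p. 120 (unrefereed preprint arXiv:2507.21400v1 under adjudication, D-0012/D-0089 — kernel support on OUR typed carrier of row 108; nothing of the source asserted)] -/
theorem Prop6_18_1a_inst :
    Prop6_18_1a (V := Fin 3) True True 0 1 2 0 (Finsupp.single 1 1) (Finsupp.single 2 1) (Finsupp.single 2 1) := by
  intro _ _
  refine ⟨⟨?_, ?_, ?_⟩, ?_⟩
  · intro x; simp
  · simp
  · simp [totalDeg]
  · intro b hb h
    simp at h
    subst h
    simp

/-- **`Prop6_18_1a` is REFUTABLE (not trivially true as typed):** with `T⁺ = T⁺' = 1` (both of degree `0`) the degree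
clause `deg T⁺ + 1 = deg T⁺'` (the integer meaning of «deg(T⁺_𝔙) = deg(T⁺_{𝔙'}) − 1», C53L93) fails.
[cite: Hu2025, Prop. 6.18 (1a) C53L85–L99, p. 120 (unrefereed preprint arXiv:2507.21400v1 under adjudication, D-0012/D-0089 — kernel support on OUR typed carrier of row 108; nothing of the source asserted)] -/
theorem not_Prop6_18_1a_inst : ¬ Prop6_18_1a (V := Fin 3) True True 0 1 2 0 0 0 0 := by
  intro h
  have := (h trivial trivial).1.2.2
  simp [totalDeg] at this

end Prop611Sanity

end Literature.AlgebraicGeometry.Hu2025.Statements.S06WpEllBlowups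

end
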